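import Summits.BirchSwinnertonDyer.BirchSwinnertonDyer.Theorems.EisensteinDepletionAtTwoStarPrimeLevelSeventeenByName
import HarnessLib

/-!
# Line `star` on crux E1M (stmt-BirchSwinnertonDyer-20341): the `2`-power isogeny graph of `17a1` made EXPLICIT, part 1 — models

Lead star-p1 GEN 19.  Purpose: remove the PRINT `Cremona1997_conductor_seventeen_classification` from line `star`.  It is used only in the
`−256`/`α = ±30` branch (`SigmaNode.false_of_seventeenShape`), where the lattice-optimal curve `W₀` has the SHAPE of `17a1` (`c₄ = 33`, `c₆ = 12015`),
to conclude that no curve of conductor `17` is a habitat curve.  Replacement (this file + …SeventeenClassWalk + …SigmaNodeSeventeenFree): `W₀ ≅ 17a1`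
over `ℚ`; the habitat curve `W` is isogenous to `W₀`; the isogeny factors as (2-power) ∘ (odd); the 2-power isogeny class of `17a1` is walked
explicitly; odd isogenies transport the type bits; and the tree's `not_prop514_of_smul_eq_cremona17` (the case analysis on the four models) ends it.

THIS FILE (pure arithmetic of the four models `17a1 = [1,−1,1,−1,−14]`, `17a2 = [1,−1,1,−6,−4]`, `17a3 = [1,−1,1,−91,−310]`, `17a4 = [1,−1,1,−1,0]`):
* §1 the complete lists of rational `2`-torsion abscissae: `{11/4}`, `{3, −5/4, −1}`, `{−21/4}`, `{1}`;
* §2 for each model `M` and each rational `2`-torsion abscissa `x'` of `M`, the codomain `K(M, x') = [0, −α/2, 0, α²/16 − 2β, 0]`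
  (`α = b₂ + 12x'`, `β = b₄ + x'b₂ + 6x'²`) of Silverman's explicit `2`-isogeny through `(x', ·)` is `ℚ`-isomorphic to one of the four models
  (six explicit changes of variables), packaged as `exists_smul_codomain_mem_of_mem`.

Fact-free; no `sorry`, no new definition; nothing here reads `r_an`; StarOptB / E1M / BSD are NOT proved (PARTITION D-0054: none — r_an ≥ 2 axis S0).
-/

set_option linter.dupNamespace false
set_option autoImplicit false

noncomputable section

open scoped Classical
open WeierstrassCurve Literature.NumberTheory.EllipticCurves Literature.NumberTheory.EllipticCurves.Greenberg1999

namespace Summit.BirchSwinnertonDyer.BirchSwinnertonDyer.Theorems.DepletionAtTwo.SeventeenClass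

/-! ### §1 Rational `2`-torsion abscissae of the four models -/

/-- `17a1 = [1,−1,1,−1,−14]`: the only rational `2`-torsion abscissa is `11/4` (`2`-division cubic `(4x − 11)((x + 1)² + 4)`).
[cite: CremonaAlgorithms1997, Table 1 (N = 17)] -/
theorem twoTorsionX_a1 {x : ℚ} (h : HasRationalTwoTorsionX (⟨1, -1, 1, -1, -14⟩ : WeierstrassCurve ℚ) x) : x = 11 / 4 := by
  obtain ⟨y, hE, h2⟩ := h
  have hc := fourXCubed_add_eq_zero_of_twoTorsion hE h2
  simp only [WeierstrassCurve.b₂, WeierstrassCurve.b₄, WeierstrassCurve.b₆] at hc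
  norm_num at hc
  have hfac : (4 * x - 11) * ((x + 1) ^ 2 + 4) = 0 := by linear_combination hc
  have hpos : (x + 1) ^ 2 + 4 ≠ 0 := by positivity
  rcases mul_eq_zero.mp hfac with h1 | h1
  · linarith
  · exact absurd h1 hpos

/-- `17a2 = [1,−1,1,−6,−4]`: the rational `2`-torsion abscissae are `3`, `−5/4`, `−1` (`2`-division cubic `(x − 3)(4x + 5)(x + 1)`).
[cite: CremonaAlgorithms1997, Table 1 (N = 17)] -/
theorem twoTorsionX_a2 {x : ℚ} (h : HasRationalTwoTorsionX (⟨1, -1, 1, -6, -4⟩ : WeierstrassCurve ℚ) x) :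
    x = 3 ∨ x = -5 / 4 ∨ x = -1 := by
  obtain ⟨y, hE, h2⟩ := h
  have hc := fourXCubed_add_eq_zero_of_twoTorsion hE h2
  simp only [WeierstrassCurve.b₂, WeierstrassCurve.b₄, WeierstrassCurve.b₆] at hc
  norm_num at hc
  have hfac : (x - 3) * ((4 * x + 5) * (x + 1)) = 0 := by linear_combination hc
  rcases mul_eq_zero.mp hfac with h1 | h1
  · left; linarith
  · rcases mul_eq_zero.mp h1 with h3 | h3
    · right; left; linarith
    · right; right; linarith

/-- `68` is not the square of a rational number (`68 = 4·17`). [folklore] -/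
theorem not_sq_eq_sixtyEight (q : ℚ) : q ^ 2 ≠ 68 := by
  intro h
  have hsq : IsSquare ((68 : ℕ) : ℚ) := ⟨q, by push_cast; rw [← h]; ring⟩
  rw [Rat.isSquare_natCast_iff] at hsq
  obtain ⟨r, hr⟩ := hsq
  have hr9 : r ≤ 9 := by nlinarith
  interval_cases r <;> omega

/-- `17` is not the square of a rational number. [folklore] -/
theorem not_sq_eq_seventeen (q : ℚ) : q ^ 2 ≠ 17 := by
  intro h
  have hsq : IsSquare ((17 : ℕ) : ℚ) := ⟨q, by push_cast; rw [← h]; ring⟩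
  rw [Rat.isSquare_natCast_iff] at hsq
  obtain ⟨r, hr⟩ := hsq
  have hr9 : r ≤ 5 := by nlinarith
  interval_cases r <;> omega

/-- `17a3 = [1,−1,1,−91,−310]`: the only rational `2`-torsion abscissa is `−21/4` (`2`-division cubic `(4x + 21)((x − 3)² − 68)`, `68 ∉ ℚ²`).
[cite: CremonaAlgorithms1997, Table 1 (N = 17)] -/
theorem twoTorsionX_a3 {x : ℚ} (h : HasRationalTwoTorsionX (⟨1, -1, 1, -91, -310⟩ : WeierstrassCurve ℚ) x) : x = -21 / 4 := by
  obtain ⟨y, hE, h2⟩ := h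
  have hc := fourXCubed_add_eq_zero_of_twoTorsion hE h2
  simp only [WeierstrassCurve.b₂, WeierstrassCurve.b₄, WeierstrassCurve.b₆] at hc
  norm_num at hc
  have hfac : (4 * x + 21) * ((x - 3) ^ 2 - 68) = 0 := by linear_combination hc
  rcases mul_eq_zero.mp hfac with h1 | h1
  · linarith
  · exact absurd (sub_eq_zero.mp h1) (not_sq_eq_sixtyEight _)

/-- `17a4 = [1,−1,1,−1,0]`: the only rational `2`-torsion abscissa is `1` (`2`-division cubic `(x − 1)(4x² + x − 1)`, `(8x+1)² = 17` impossible).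
[cite: CremonaAlgorithms1997, Table 1 (N = 17)] -/
theorem twoTorsionX_a4 {x : ℚ} (h : HasRationalTwoTorsionX (⟨1, -1, 1, -1, 0⟩ : WeierstrassCurve ℚ) x) : x = 1 := by
  obtain ⟨y, hE, h2⟩ := h
  have hc := fourXCubed_add_eq_zero_of_twoTorsion hE h2
  simp only [WeierstrassCurve.b₂, WeierstrassCurve.b₄, WeierstrassCurve.b₆] at hc
  norm_num at hc
  have hfac : (x - 1) * ((8 * x + 1) ^ 2 - 17) = 0 := by linear_combination 16 * hc
  rcases mul_eq_zero.mp hfac with h1 | h1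
  · linarith
  · exact absurd (sub_eq_zero.mp h1) (not_sq_eq_seventeen _)

/-! ### §2 The six `2`-isogeny codomains, identified -/

/-- `K(17a1, 11/4) = [0, −15, 0, −16, 0]` (`α = 30`, `β = 289/8`) and `(2, 4, 1, 4) • K = 17a2`. [cite: SilvermanAEC2009, III.4 Example 4.5 and III.1 Table 3.1] -/
theorem codomain_a1 :
    (⟨⟨(2 : ℚ), 1 / 2, by norm_num, by norm_num⟩, 4, 1, 4⟩ : VariableChange ℚ) •
        (⟨0, -((⟨1, -1, 1, -1, -14⟩ : WeierstrassCurve ℚ).b₂ + 12 * (11 / 4 : ℚ)) / 2, 0,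
          ((⟨1, -1, 1, -1, -14⟩ : WeierstrassCurve ℚ).b₂ + 12 * (11 / 4 : ℚ)) ^ 2 / 16 -
            2 * ((⟨1, -1, 1, -1, -14⟩ : WeierstrassCurve ℚ).b₄ + (11 / 4 : ℚ) * (⟨1, -1, 1, -1, -14⟩ : WeierstrassCurve ℚ).b₂ +
              6 * (11 / 4 : ℚ) ^ 2), 0⟩ : WeierstrassCurve ℚ) =
      (⟨1, -1, 1, -6, -4⟩ : WeierstrassCurve ℚ) := by
  simp only [WeierstrassCurve.b₂, WeierstrassCurve.b₄]
  rw [variableChange_def]; ext <;> norm_num [Units.inv_mk]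

/-- `K(17a2, 3) = [0, −33/2, 0, 1/16, 0]` and `(1, 21/4, 1/2, 1/2) • K = 17a3`. [cite: SilvermanAEC2009, III.4 Example 4.5 and III.1 Table 3.1] -/
theorem codomain_a2_three :
    (⟨1, 21 / 4, 1 / 2, 1 / 2⟩ : VariableChange ℚ) •
        (⟨0, -((⟨1, -1, 1, -6, -4⟩ : WeierstrassCurve ℚ).b₂ + 12 * (3 : ℚ)) / 2, 0,
          ((⟨1, -1, 1, -6, -4⟩ : WeierstrassCurve ℚ).b₂ + 12 * (3 : ℚ)) ^ 2 / 16 -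
            2 * ((⟨1, -1, 1, -6, -4⟩ : WeierstrassCurve ℚ).b₄ + (3 : ℚ) * (⟨1, -1, 1, -6, -4⟩ : WeierstrassCurve ℚ).b₂ + 6 * (3 : ℚ) ^ 2),
          0⟩ : WeierstrassCurve ℚ) =
      (⟨1, -1, 1, -91, -310⟩ : WeierstrassCurve ℚ) := by
  simp only [WeierstrassCurve.b₂, WeierstrassCurve.b₄]
  rw [variableChange_def]; ext <;> norm_num

/-- `K(17a2, −5/4) = [0, 9, 0, 16, 0]` and `(2, −4, 1, 4) • K = 17a4`. [cite: SilvermanAEC2009, III.4 Example 4.5 and III.1 Table 3.1] -/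
theorem codomain_a2_negFiveQuarters :
    (⟨⟨(2 : ℚ), 1 / 2, by norm_num, by norm_num⟩, -4, 1, 4⟩ : VariableChange ℚ) •
        (⟨0, -((⟨1, -1, 1, -6, -4⟩ : WeierstrassCurve ℚ).b₂ + 12 * (-5 / 4 : ℚ)) / 2, 0,
          ((⟨1, -1, 1, -6, -4⟩ : WeierstrassCurve ℚ).b₂ + 12 * (-5 / 4 : ℚ)) ^ 2 / 16 -
            2 * ((⟨1, -1, 1, -6, -4⟩ : WeierstrassCurve ℚ).b₄ + (-5 / 4 : ℚ) * (⟨1, -1, 1, -6, -4⟩ : WeierstrassCurve ℚ).b₂ +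
              6 * (-5 / 4 : ℚ) ^ 2), 0⟩ : WeierstrassCurve ℚ) =
      (⟨1, -1, 1, -1, 0⟩ : WeierstrassCurve ℚ) := by
  simp only [WeierstrassCurve.b₂, WeierstrassCurve.b₄]
  rw [variableChange_def]; ext <;> norm_num [Units.inv_mk]

/-- `K(17a2, −1) = [0, 15/2, 0, 289/16, 0]` and `(1, −11/4, 1/2, 1/2) • K = 17a1`. [cite: SilvermanAEC2009, III.4 Example 4.5 and III.1 Table 3.1] -/
theorem codomain_a2_negOne :
    (⟨1, -11 / 4, 1 / 2, 1 / 2⟩ : VariableChange ℚ) •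
        (⟨0, -((⟨1, -1, 1, -6, -4⟩ : WeierstrassCurve ℚ).b₂ + 12 * (-1 : ℚ)) / 2, 0,
          ((⟨1, -1, 1, -6, -4⟩ : WeierstrassCurve ℚ).b₂ + 12 * (-1 : ℚ)) ^ 2 / 16 -
            2 * ((⟨1, -1, 1, -6, -4⟩ : WeierstrassCurve ℚ).b₄ + (-1 : ℚ) * (⟨1, -1, 1, -6, -4⟩ : WeierstrassCurve ℚ).b₂ + 6 * (-1 : ℚ) ^ 2),
          0⟩ : WeierstrassCurve ℚ) =
      (⟨1, -1, 1, -1, -14⟩ : WeierstrassCurve ℚ) := by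
  simp only [WeierstrassCurve.b₂, WeierstrassCurve.b₄]
  rw [variableChange_def]; ext <;> norm_num

/-- `K(17a3, −21/4) = [0, 33, 0, 272, 0]` and `(2, −12, 1, 4) • K = 17a2`. [cite: SilvermanAEC2009, III.4 Example 4.5 and III.1 Table 3.1] -/
theorem codomain_a3 :
    (⟨⟨(2 : ℚ), 1 / 2, by norm_num, by norm_num⟩, -12, 1, 4⟩ : VariableChange ℚ) •
        (⟨0, -((⟨1, -1, 1, -91, -310⟩ : WeierstrassCurve ℚ).b₂ + 12 * (-21 / 4 : ℚ)) / 2, 0,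
          ((⟨1, -1, 1, -91, -310⟩ : WeierstrassCurve ℚ).b₂ + 12 * (-21 / 4 : ℚ)) ^ 2 / 16 -
            2 * ((⟨1, -1, 1, -91, -310⟩ : WeierstrassCurve ℚ).b₄ + (-21 / 4 : ℚ) * (⟨1, -1, 1, -91, -310⟩ : WeierstrassCurve ℚ).b₂ +
              6 * (-21 / 4 : ℚ) ^ 2), 0⟩ : WeierstrassCurve ℚ) =
      (⟨1, -1, 1, -6, -4⟩ : WeierstrassCurve ℚ) := by
  simp only [WeierstrassCurve.b₂, WeierstrassCurve.b₄]
  rw [variableChange_def]; ext <;> norm_num [Units.inv_mk]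

/-- `K(17a4, 1) = [0, −9/2, 0, 17/16, 0]` and `(1, 5/4, 1/2, 1/2) • K = 17a2`. [cite: SilvermanAEC2009, III.4 Example 4.5 and III.1 Table 3.1] -/
theorem codomain_a4 :
    (⟨1, 5 / 4, 1 / 2, 1 / 2⟩ : VariableChange ℚ) •
        (⟨0, -((⟨1, -1, 1, -1, 0⟩ : WeierstrassCurve ℚ).b₂ + 12 * (1 : ℚ)) / 2, 0,
          ((⟨1, -1, 1, -1, 0⟩ : WeierstrassCurve ℚ).b₂ + 12 * (1 : ℚ)) ^ 2 / 16 -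
            2 * ((⟨1, -1, 1, -1, 0⟩ : WeierstrassCurve ℚ).b₄ + (1 : ℚ) * (⟨1, -1, 1, -1, 0⟩ : WeierstrassCurve ℚ).b₂ + 6 * (1 : ℚ) ^ 2),
          0⟩ : WeierstrassCurve ℚ) =
      (⟨1, -1, 1, -6, -4⟩ : WeierstrassCurve ℚ) := by
  simp only [WeierstrassCurve.b₂, WeierstrassCurve.b₄]
  rw [variableChange_def]; ext <;> norm_num

/-- **The `2`-isogeny graph of `17a` is closed**: for each of the four models `M` and each rational `2`-torsion abscissa `x'` of `M`, the codomain
`K(M, x') = [0, −α/2, 0, α²/16 − 2β, 0]` of the explicit `2`-isogeny through `(x', ·)` is `ℚ`-isomorphic to one of the four models.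
[cite: SilvermanAEC2009, III.4 Example 4.5] [cite: CremonaAlgorithms1997, Table 1 (N = 17: isogeny class 17a)] -/
theorem exists_smul_codomain_mem_of_mem (M : WeierstrassCurve ℚ)
    (hM : M = ⟨1, -1, 1, -1, -14⟩ ∨ M = ⟨1, -1, 1, -6, -4⟩ ∨ M = ⟨1, -1, 1, -91, -310⟩ ∨ M = ⟨1, -1, 1, -1, 0⟩)
    {x' : ℚ} (hx' : HasRationalTwoTorsionX M x') :
    ∃ D : VariableChange ℚ,
      D • (⟨0, -(M.b₂ + 12 * x') / 2, 0, (M.b₂ + 12 * x') ^ 2 / 16 - 2 * (M.b₄ + x' * M.b₂ + 6 * x' ^ 2), 0⟩ : WeierstrassCurve ℚ) =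
          ⟨1, -1, 1, -1, -14⟩ ∨
      D • (⟨0, -(M.b₂ + 12 * x') / 2, 0, (M.b₂ + 12 * x') ^ 2 / 16 - 2 * (M.b₄ + x' * M.b₂ + 6 * x' ^ 2), 0⟩ : WeierstrassCurve ℚ) =
          ⟨1, -1, 1, -6, -4⟩ ∨
      D • (⟨0, -(M.b₂ + 12 * x') / 2, 0, (M.b₂ + 12 * x') ^ 2 / 16 - 2 * (M.b₄ + x' * M.b₂ + 6 * x' ^ 2), 0⟩ : WeierstrassCurve ℚ) =
          ⟨1, -1, 1, -91, -310⟩ ∨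
      D • (⟨0, -(M.b₂ + 12 * x') / 2, 0, (M.b₂ + 12 * x') ^ 2 / 16 - 2 * (M.b₄ + x' * M.b₂ + 6 * x' ^ 2), 0⟩ : WeierstrassCurve ℚ) =
          ⟨1, -1, 1, -1, 0⟩ := by
  rcases hM with rfl | rfl | rfl | rfl
  · obtain rfl := twoTorsionX_a1 hx'
    exact ⟨_, Or.inr (Or.inl codomain_a1)⟩
  · rcases twoTorsionX_a2 hx' with rfl | rfl | rfl
    · exact ⟨_, Or.inr (Or.inr (Or.inl codomain_a2_three))⟩
    · exact ⟨_, Or.inr (Or.inr (Or.inr codomain_a2_negFiveQuarters))⟩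
    · exact ⟨_, Or.inl codomain_a2_negOne⟩
  · obtain rfl := twoTorsionX_a3 hx'
    exact ⟨_, Or.inr (Or.inl codomain_a3)⟩
  · obtain rfl := twoTorsionX_a4 hx'
    exact ⟨_, Or.inr (Or.inl codomain_a4)⟩

end Summit.BirchSwinnertonDyer.BirchSwinnertonDyer.Theorems.DepletionAtTwo.SeventeenClass

end
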